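import Literature.Computability.Complexity.TVCheckerBricks
import Literature.Computability.Complexity.TVDownwardCheckerAnalysis
import HarnessLib

/-!
# `FP` bricks for the downward checker of Trevisan–Vadhan's language, II: stage data, points along a
# run, query words and the oracle's answer blocks

Literature / complexity — second machine layer of the downward checker (sequel of
`TVCheckerBricks.lean`; analysis in `TVDownwardCheckerAnalysis.lean`). A run of the LFKN verifier
started at stage `i` of Trevisan–Vadhan's fine schedule reads, at its stage `s` (absolute index
`k = i + s`), the operator `(uops n)[k]` — block `b = k / (N n + 1)`, offset `k % (N n + 1)`: the
quantifier of `x_b` at offset `0`, else the linearization of variable `offset - 1` — its axis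
variable (`QBFUniv.opVar`), the number `stageDeg n k + 1` of interpolation nodes, the point reached
after substituting the first `s` challenges (`ChainCheck.Chain.pointSeq`), and for every node the
`blk n` answers of the oracle at the query words of the shifted point (`QBFUniv.wordOf` at length
`h n (k+1)`). In the brick algebra (`BrickAlgebra`, `FoldBricks`, `HardLangMachine`):

* `TVChk.udivmodF` (unary division with remainder by a counted fold), `TVChk.nSuccOf` (`1^{N n + 1}`);
* the stage data on `⟨1ⁿ, 1ᵏ⟩`: `TVChk.offOf`, `blkIxOf`, `isQuantOf`, `axisOf` (`= opVar (uops n)[k]`,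
  `axisOf_length`), `selOf` (the selector index `lay n (s_b)`), `degOf` (`= stageDeg n k + 1` ones,
  `degOf_length`);
* `TVChk.writeBlkF` (replace block `v` of a point string; `ptBits_update`), the challenge reader and
  **`TVChk.pointF`** (the point of stage `s` of run `t`: a counted fold of block writes;
  `pointF_apply = ptBits n (pointSeq …)`);
* `TVChk.qwordF` (the query word of a point string, a selector and a padding count; `= wordOf`),
  `TVChk.ansBitF acc` (one oracle answer, the oracle PRESENTED by an access brick `acc` applied to
  `⟨query, e⟩` for a carrier string `e`), `TVChk.ansBlkF acc` (the `blk n` answers at one point: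
  `= bits (Mof n) (pointOracle A n lvl y)`), **`TVChk.nodeAnsF acc`** (the answer blocks at the
  `D` nodes of the axis line: the string `Y` that `TVChk.lagF` consumes).

The oracle enters only through `acc`: every brick `B acc` comes with `acc ∈ FP → B acc ∈ FP`, and
its value is stated for the Boolean oracle `q ↦ (acc ⟨q, e⟩ = [true])`. Everything is proved;
definitions are `FP` string functions (no named facts, D-0026).

## References

* C. Lund, L. Fortnow, H. Karloff, N. Nisan, J. ACM 39 (1992), §3 [LundEtAl1992].
* L. Trevisan, S. Vadhan, Comput. Complexity 16 (2007), Thm. 4.3 (proof: the layout of the words),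
  Lemma 4.1 [TrevisanVadhan2007].
* S. Arora, B. Barak, CUP 2009, §1.3 (composition, bounded loops), §8.3.3 [AroraBarakCC2009].
-/

noncomputable section

namespace Literature.Computability.Complexity

namespace TVChk

open _root_.Computability Polynomial Finset Brick Plumb GF2Str HardLangM TVBrick QBFUniv SelfCorrect
  Literature.InformationTheory.Coding

/-! ### Unary division with remainder -/

/-- One round of the division fold on `⟨⟨1^q, 1^r⟩, 1^c⟩`: `r + 1 < c ? ⟨1^q, 1^{r+1}⟩ : ⟨1^{q+1}, ε⟩`.
[folklore] -/
def dmOpF : List Bool → List Bool :=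
  iteFn (ltLenF ∘ fanoutFn (List.cons true ∘ sndF ∘ fstF) sndF)
    (fanoutFn (fstF ∘ fstF) (List.cons true ∘ sndF ∘ fstF))
    (fanoutFn (List.cons true ∘ fstF ∘ fstF) (fun _ => []))

/-- `dmOpF ∈ FP`. [folklore] -/
theorem dmOpF_mem_FP : dmOpF ∈ FP :=
  iteFn_mem_FP (comp_mem_FP ltLenF_mem_FP (fanoutFn_mem_FP (comp_mem_FP (cons_mem_FP true) (comp_mem_FP sndF_mem_FP fstF_mem_FP))
    sndF_mem_FP))
    (fanoutFn_mem_FP (comp_mem_FP fstF_mem_FP fstF_mem_FP) (comp_mem_FP (cons_mem_FP true) (comp_mem_FP sndF_mem_FP fstF_mem_FP)))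
    (fanoutFn_mem_FP (comp_mem_FP (cons_mem_FP true) (comp_mem_FP fstF_mem_FP fstF_mem_FP)) (const_mem_FP _))

/-- Value of one round. [folklore] -/
theorem dmOpF_apply (q r c : ℕ) :
    dmOpF (boolPair (boolPair (ones q) (ones r)) (ones c)) =
      if r + 1 < c then boolPair (ones q) (ones (r + 1)) else boolPair (ones (q + 1)) [] := by
  have hc : (ltLenF ∘ fanoutFn (List.cons true ∘ sndF ∘ fstF) sndF) (boolPair (boolPair (ones q) (ones r)) (ones c)) =
      [decide (r + 1 < c)] := by
    simp [ones]
  rw [dmOpF, iteFn_apply hc]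
  by_cases h : r + 1 < c
  · rw [if_pos h, decide_eq_true h]; simp [ones, List.replicate_succ]
  · rw [if_neg h, decide_eq_false h]; simp [ones, List.replicate_succ]

/-- Growth of one round: at most `5` more symbols than the accumulator, on every input. [folklore] -/
theorem length_dmOpF_le (w : List Bool) : (dmOpF w).length ≤ (fstF w).length + (sndF w).length + 5 := by
  have h1 := length_fstF_sndF_le (fstF w)
  rw [dmOpF, iteFn_of_oneBit (oneBit_ltLenF.comp _)]
  split_ifs <;> simp only [fanoutFn_apply, Function.comp_apply, length_boolPair, List.length_cons, List.length_nil] <;> omega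

/-- The arithmetic of one round: from `(k / c, k % c)` to `((k+1) / c, (k+1) % c)`. [folklore] -/
theorem divmod_step {c : ℕ} (hc : 0 < c) (k : ℕ) :
    (if k % c + 1 < c then (k / c, k % c + 1) else (k / c + 1, 0)) = ((k + 1) / c, (k + 1) % c) := by
  have hdm := Nat.div_add_mod k c
  have hlt := Nat.mod_lt k hc
  split_ifs with h
  · obtain ⟨h1, h2⟩ := (Nat.div_mod_unique hc).2 ⟨show (k % c + 1) + c * (k / c) = k + 1 by omega, h⟩
    rw [h1, h2]
  · obtain ⟨h1, h2⟩ := (Nat.div_mod_unique hc).2 ⟨show 0 + c * (k / c + 1) = k + 1 by rw [Nat.mul_succ]; omega, hc⟩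
    rw [h1, h2]

/-- The constant piece of the division fold: `1ᶜ` (the second field of the context `⟨1ᵃ, 1ᶜ⟩`). [folklore] -/
def dmPieceF : List Bool → List Bool := sndF ∘ fstF

/-- The model of the division fold: after `k` rounds from `⟨1⁰, 1⁰⟩` the accumulator is
`⟨1^{k / c}, 1^{k % c}⟩`. [folklore] -/
theorem dm_foldAcc {c : ℕ} (hc : 0 < c) (a : ℕ) : ∀ k : ℕ,
    foldAcc dmOpF dmPieceF (boolPair (ones a) (ones c)) 0 k (boolPair (ones 0) (ones 0)) =
      boolPair (ones (k / c)) (ones (k % c))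
  | 0 => by simp [Nat.zero_div, Nat.zero_mod]
  | k + 1 => by
    rw [foldAcc_succ', dm_foldAcc hc a k]
    have hp : dmPieceF (boolPair (boolPair (ones a) (ones c)) (ones (0 + k))) = ones c := by simp [dmPieceF]
    rw [hp, dmOpF_apply]
    have hs := divmod_step hc k
    by_cases h : k % c + 1 < c
    · rw [if_pos h] at hs ⊢
      obtain ⟨h1, h2⟩ := Prod.mk.inj hs
      rw [← h1, ← h2]
    · rw [if_neg h] at hs ⊢
      obtain ⟨h1, h2⟩ := Prod.mk.inj hs
      rw [← h1, ← h2]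
      rfl

/-- Initialisation of the division fold: `⟨x, ⟨encodeNat a, ⟨1⁰, ⟨1⁰, 1⁰⟩⟩⟩⟩` on `x = ⟨1ᵃ, 1ᶜ⟩`. [folklore] -/
def initDM : List Bool → List Bool :=
  fanoutFn (fun w => w) (fanoutFn (lenBinF ∘ fstF) (fun _ => boolPair [] (boolPair [] [])))

/-- `initDM ∈ FP`. [folklore] -/
theorem initDM_mem_FP : initDM ∈ FP :=
  fanoutFn_mem_FP (PolyTimeComputable.id _) (fanoutFn_mem_FP (comp_mem_FP lenBinF_mem_FP fstF_mem_FP) (const_mem_FP _))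

/-- **Unary division with remainder**: `⟨1ᵃ, 1ᶜ⟩ ↦ ⟨1^{a / c}, 1^{a % c}⟩` (`c ≥ 1`), a counted fold of
`a` increments. [folklore] -/
def udivmodF : List Bool → List Bool := sndPow 2 ∘ foldLoop dmOpF (clipF 1 dmPieceF) X ∘ initDM

/-- **`udivmodF ∈ FP`.** [folklore] -/
theorem udivmodF_mem_FP : udivmodF ∈ FP :=
  comp_mem_FP (sndPow_mem_FP 2) (comp_mem_FP (foldLoop_clipF_mem_FP 1 dmOpF_mem_FP length_dmOpF_le
    (comp_mem_FP sndF_mem_FP fstF_mem_FP) _) initDM_mem_FP)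

/-- **Value of `udivmodF`.** [folklore] -/
theorem udivmodF_apply (a : ℕ) {c : ℕ} (hc : 0 < c) :
    udivmodF (boolPair (ones a) (ones c)) = boolPair (ones (a / c)) (ones (a % c)) := by
  have hk : a ≤ (X : Polynomial ℕ).eval (boolPair (ones a) (ones c)).length := by
    simp only [eval_X, length_boolPair, ones, List.length_replicate]; omega
  have hinit : initDM (boolPair (ones a) (ones c)) =
      boolPair (boolPair (ones a) (ones c)) (boolPair (encodeNat a) (boolPair (ones 0) (boolPair (ones 0) (ones 0)))) := by
    simp [initDM, ones]
  rw [udivmodF, Function.comp_apply, Function.comp_apply, hinit, foldLoop_apply _ _ hk, sndPow_succ_boolPair,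
    sndPow_succ_boolPair, sndPow_zero_boolPair,
    foldAcc_clipF (fun j _ _ => by simp only [dmPieceF, Function.comp_apply, fstF_boolPair, sndF_boolPair, ones,
      List.length_replicate, length_boolPair]; omega), dm_foldAcc hc a a]

/-! ### `1^{N n + 1}` and the stage data -/

/-- **`1^{N n + 1}` from `1ⁿ`** (`N n = 2n² + 2n`, via the index brick `idxS` at `k = n`). [folklore] -/
def nSuccOf : List Bool → List Bool := List.cons true ∘ idxS ∘ fanoutFn (fun w => w) (fanoutFn (fun w => w) (fun w => w))

/-- `nSuccOf ∈ FP`. [folklore] -/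
theorem nSuccOf_mem_FP : nSuccOf ∈ FP :=
  comp_mem_FP (cons_mem_FP true) (comp_mem_FP idx_mem_FP.2.2.2 (fanoutFn_mem_FP (PolyTimeComputable.id _)
    (fanoutFn_mem_FP (PolyTimeComputable.id _) (PolyTimeComputable.id _))))

/-- Value of `nSuccOf`. [folklore] -/
theorem nSuccOf_apply (n : ℕ) : nSuccOf (ones n) = ones (N n + 1) := by
  rw [nSuccOf, Function.comp_apply, Function.comp_apply, fanoutFn_apply, fanoutFn_apply, (idx_apply n n n).2.2.2, N_eq]
  simp only [ones, ← List.replicate_succ]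
  congr 1; ring

/-- The stage record `⟨1ⁿ, 1ᵏ⟩` (size and absolute stage index). [folklore] -/
def sCtx (n k : ℕ) : List Bool := boolPair (ones n) (ones k)

/-- `⟨1^{k / (N n + 1)}, 1^{k % (N n + 1)}⟩` of the stage record. [folklore] -/
def dmOf : List Bool → List Bool := udivmodF ∘ fanoutFn sndF (nSuccOf ∘ fstF)

/-- `dmOf ∈ FP`. [folklore] -/
theorem dmOf_mem_FP : dmOf ∈ FP :=
  comp_mem_FP udivmodF_mem_FP (fanoutFn_mem_FP sndF_mem_FP (comp_mem_FP nSuccOf_mem_FP fstF_mem_FP))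

/-- Value of `dmOf`. [folklore] -/
theorem dmOf_apply (n k : ℕ) : dmOf (sCtx n k) = boolPair (ones (k / (N n + 1))) (ones (k % (N n + 1))) := by
  rw [dmOf, Function.comp_apply, fanoutFn_apply, sCtx, sndF_boolPair, Function.comp_apply, fstF_boolPair, nSuccOf_apply,
    udivmodF_apply _ (Nat.succ_pos _)]

/-- **The block index** `1ᵇ`, `b = k / (N n + 1)`. [folklore] -/
def blkIxOf : List Bool → List Bool := fstF ∘ dmOf
/-- **The offset** `1^{k % (N n + 1)}`. [folklore] -/
def offOf : List Bool → List Bool := sndF ∘ dmOf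
/-- **Quantifier stage?** `[k % (N n + 1) = 0]`. [folklore] -/
def isQuantOf : List Bool → List Bool := isNilFn ∘ offOf

/-- These are in `FP`. [folklore] -/
theorem sdata_mem_FP : blkIxOf ∈ FP ∧ offOf ∈ FP ∧ isQuantOf ∈ FP :=
  ⟨comp_mem_FP fstF_mem_FP dmOf_mem_FP, comp_mem_FP sndF_mem_FP dmOf_mem_FP,
    comp_mem_FP isNilFn_mem_FP (comp_mem_FP sndF_mem_FP dmOf_mem_FP)⟩

/-- Values of the block index, offset and quantifier flag. [folklore] -/
theorem sdata_apply (n k : ℕ) :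
    blkIxOf (sCtx n k) = ones (k / (N n + 1)) ∧ offOf (sCtx n k) = ones (k % (N n + 1)) ∧
      isQuantOf (sCtx n k) = [decide (k % (N n + 1) = 0)] := by
  refine ⟨by rw [blkIxOf, Function.comp_apply, dmOf_apply, fstF_boolPair],
    by rw [offOf, Function.comp_apply, dmOf_apply, sndF_boolPair], ?_⟩
  rw [isQuantOf, Function.comp_apply, offOf, Function.comp_apply, dmOf_apply, sndF_boolPair, isNilFn]
  simp [ones, List.replicate_eq_nil_iff]

/-- **The axis variable of stage `k`** (in unary): `x_b` (index `2n² + b`) at a quantifier stage, else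
variable `offset - 1`. [cite: TrevisanVadhan2007, Lemma 4.1 (proof)] -/
def axisOf : List Bool → List Bool :=
  iteFn isQuantOf (idxX ∘ fanoutFn fstF (fanoutFn fstF blkIxOf)) (dropFn ∘ fanoutFn (fun _ => [true]) offOf)

/-- **The selector variable of the block** `s_b` (index `2n² + n + b`; read at quantifier stages). [cite: TrevisanVadhan2007, Lemma 4.1 (proof)] -/
def selOf : List Bool → List Bool := idxS ∘ fanoutFn fstF (fanoutFn fstF blkIxOf)

/-- `axisOf, selOf ∈ FP`. [folklore] -/
theorem axisSel_mem_FP : axisOf ∈ FP ∧ selOf ∈ FP := by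
  obtain ⟨hb, ho, hq⟩ := sdata_mem_FP
  exact ⟨iteFn_mem_FP hq (comp_mem_FP idx_mem_FP.2.2.1 (fanoutFn_mem_FP fstF_mem_FP (fanoutFn_mem_FP fstF_mem_FP hb)))
      (comp_mem_FP dropFn_mem_FP (fanoutFn_mem_FP (const_mem_FP _) ho)),
    comp_mem_FP idx_mem_FP.2.2.2 (fanoutFn_mem_FP fstF_mem_FP (fanoutFn_mem_FP fstF_mem_FP hb))⟩

/-- **The axis brick computes `opVar (uops n)[k]`** (in unary). [cite: TrevisanVadhan2007, Lemma 4.1 (proof)] -/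
theorem axisOf_apply {n k : ℕ} (hk : k < mlen n) :
    axisOf (sCtx n k) = ones (opVar ((uops n)[k]'(by rwa [mlen] at hk))).val := by
  obtain ⟨b, t, ht, rfl⟩ := exists_block_of_lt_mlen hk
  obtain ⟨hmod, hdiv⟩ := block_divMod (n := n) b.val t ht
  obtain ⟨hB, hO, hQ⟩ := sdata_apply n (b.val * (N n + 1) + t)
  rw [hmod] at hO hQ
  rw [hdiv] at hB
  rcases t with _ | v
  · have hget : (uops n)[b.val * (N n + 1) + 0]'(by rwa [mlen] at hk) = UOp.quant b := by
      simp only [Nat.add_zero]; exact uops_getElem_zero n b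
    rw [hget, opVar, lay_x_val, axisOf, iteFn_apply hQ, decide_eq_true rfl, if_pos rfl, Function.comp_apply, fanoutFn_apply,
      fanoutFn_apply, hB, sCtx, fstF_boolPair, (idx_apply n n b.val).2.2.1]
  · have hv : v < N n := by omega
    have hget : (uops n)[b.val * (N n + 1) + (v + 1)]'(by rwa [mlen] at hk) = UOp.lin ⟨v, hv⟩ := uops_getElem_succ n b ⟨v, hv⟩
    rw [hget, opVar, axisOf, iteFn_apply hQ, decide_eq_false (Nat.succ_ne_zero v), if_neg Bool.false_ne_true,
      Function.comp_apply, fanoutFn_apply, hO, dropFn_boolPair]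
    simp [ones]

/-- The block of a stage is a block of the schedule. [folklore] -/
theorem block_lt_of_lt_mlen {n k : ℕ} (hk : k < mlen n) : k / (N n + 1) < n := by
  rw [mlen, length_uops] at hk
  exact (Nat.div_lt_iff_lt_mul (Nat.succ_pos _)).2 hk

/-- **The selector brick computes `lay n (s_b)`** (in unary), `b` the block of stage `k`. [cite: TrevisanVadhan2007, Lemma 4.1 (proof)] -/
theorem selOf_apply {n k : ℕ} (hk : k < mlen n) :
    selOf (sCtx n k) = ones (lay n (.s ⟨k / (N n + 1), block_lt_of_lt_mlen hk⟩)).val := by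
  obtain ⟨hB, -, -⟩ := sdata_apply n k
  rw [selOf, Function.comp_apply, fanoutFn_apply, fanoutFn_apply, hB, sCtx, fstF_boolPair, (idx_apply n n (k / (N n + 1))).2.2.2,
    lay_s_val]

/-- **The node count of stage `k`** in unary: `1^{stageDeg n k + 1}` — `2` at a quantifier stage,
`2n + 1` in the innermost sweep (`n ≥ 1`), `4` elsewhere. [cite: AroraBarakCC2009, §8.3.3] -/
def degOf : List Bool → List Bool :=
  iteFn isQuantOf (fun _ => ones 2)
    (iteFn (eqPairFn ∘ fanoutFn (List.cons true ∘ blkIxOf) fstF)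
      (List.cons true ∘ appF ∘ fanoutFn fstF fstF) (fun _ => ones 4))

/-- `degOf ∈ FP`. [folklore] -/
theorem degOf_mem_FP : degOf ∈ FP := by
  obtain ⟨hb, -, hq⟩ := sdata_mem_FP
  exact iteFn_mem_FP hq (const_mem_FP _) (iteFn_mem_FP (comp_mem_FP eqPairFn_mem_FP (fanoutFn_mem_FP
    (comp_mem_FP (cons_mem_FP true) hb) fstF_mem_FP)) (comp_mem_FP (cons_mem_FP true) (comp_mem_FP appF_mem_FP
      (fanoutFn_mem_FP fstF_mem_FP fstF_mem_FP))) (const_mem_FP _))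

/-- **The node-count brick computes `1^{stageDeg n k + 1}`** (`n ≥ 1`). [cite: AroraBarakCC2009, §8.3.3] -/
theorem degOf_apply {n : ℕ} (hn : 0 < n) (k : ℕ) : degOf (sCtx n k) = ones (stageDeg n k + 1) := by
  obtain ⟨hB, -, hQ⟩ := sdata_apply n k
  rw [degOf, iteFn_apply hQ, stageDeg]
  by_cases h0 : k % (N n + 1) = 0
  · rw [decide_eq_true h0, if_pos rfl, if_pos h0]
  · rw [decide_eq_false h0, if_neg Bool.false_ne_true, if_neg h0]
    have hc : (eqPairFn ∘ fanoutFn (List.cons true ∘ blkIxOf) fstF) (sCtx n k) = [decide (k / (N n + 1) + 1 = n)] := by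
      rw [Function.comp_apply, fanoutFn_apply, Function.comp_apply, hB, sCtx, fstF_boolPair, eqPairFn_boolPair]
      congr 2
      refine propext ⟨fun h => ?_, fun h => ?_⟩
      · have := congrArg List.length h; simp [ones] at this; omega
      · conv_rhs => rw [← h]
        rfl
    rw [iteFn_apply hc, blockBound]
    by_cases hb : k / (N n + 1) + 1 = n
    · rw [decide_eq_true hb, if_pos rfl, if_pos hb, max_eq_right (by omega)]
      simp only [Function.comp_apply, fanoutFn_apply, sCtx, fstF_boolPair, appF_boolPair, ones, List.replicate_append_replicate,
        ← List.replicate_succ]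
      congr 1; omega
    · rw [decide_eq_false hb, if_neg Bool.false_ne_true, if_neg hb]
      rfl

/-! ### Point strings: blocks, updates, the point read off a word -/

/-- **An entry of the point string**: entry `p < ptLen n` is bit `p % blk n` of coordinate `p / blk n`.
[folklore] -/
theorem getD_ptBits_any (n : ℕ) (x : Fin (N n) → K n) {p : ℕ} (hp : p < ptLen n) :
    (ptBits n x).getD p false =
      encF (Mof n) (x ⟨p / blk n, (Nat.div_lt_iff_lt_mul (blk_pos n)).2 hp⟩) ⟨p % blk n, Nat.mod_lt _ (blk_pos n)⟩ := by
  have key := getD_ptBits n x ⟨p / blk n, (Nat.div_lt_iff_lt_mul (blk_pos n)).2 hp⟩ ⟨p % blk n, Nat.mod_lt _ (blk_pos n)⟩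
  simp only [Nat.div_add_mod'] at key
  exact key

/-- The same, for `getElem`. [folklore] -/
theorem getElem_ptBits (n : ℕ) (x : Fin (N n) → K n) {p : ℕ} (hp : p < (ptBits n x).length) :
    (ptBits n x)[p] = encF (Mof n) (x ⟨p / blk n, (Nat.div_lt_iff_lt_mul (blk_pos n)).2 (by rw [length_ptBits] at hp; exact hp)⟩)
      ⟨p % blk n, Nat.mod_lt _ (blk_pos n)⟩ := by
  rw [← List.getD_eq_getElem _ false hp, getD_ptBits_any n x (by rw [length_ptBits] at hp; exact hp)]

/-- **Updating one coordinate rewrites one block.** [folklore] -/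
theorem ptBits_update (n : ℕ) (x : Fin (N n) → K n) (v : Fin (N n)) (ρ : K n) :
    ptBits n (Function.update x v ρ) =
      (ptBits n x).take (v.val * blk n) ++ bits (Mof n) ρ ++ (ptBits n x).drop ((v.val + 1) * blk n) := by
  have hv := v.isLt
  have hblk : blk n = Mof n + 1 := rfl
  have hpt : ptLen n = N n * blk n := rfl
  have hlen1 : v.val * blk n + blk n ≤ ptLen n := by
    rw [ptLen, ← Nat.succ_mul]; exact Nat.mul_le_mul_right _ hv
  apply List.ext_getElem
  · simp only [length_ptBits, List.length_append, List.length_take, List.length_drop, length_bits, Nat.succ_mul]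
    omega
  · intro p h1 h2
    rw [length_ptBits] at h1
    rw [getElem_ptBits]
    by_cases hp1 : p < v.val * blk n
    · rw [List.getElem_append_left (by simp [length_bits]; omega), List.getElem_append_left (by simp; omega),
        List.getElem_take, getElem_ptBits]
      have hne : (⟨p / blk n, (Nat.div_lt_iff_lt_mul (blk_pos n)).2 h1⟩ : Fin (N n)) ≠ v := by
        intro h
        have h' := congrArg Fin.val h
        simp only at h'
        have := Nat.div_mul_le_self p (blk n)
        rw [h'] at this
        omega
      simp only [Function.update_of_ne hne]
    · push Not at hp1
      by_cases hp2 : p < v.val * blk n + blk n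
      · rw [List.getElem_append_left (by simp [length_bits]; omega), List.getElem_append_right (by simp; omega)]
        have hq : p / blk n = v.val := Nat.div_eq_of_lt_le hp1 (by rw [Nat.succ_mul]; exact hp2)
        have hr : p % blk n = p - v.val * blk n := by
          have := Nat.div_add_mod' p (blk n)
          rw [hq] at this
          omega
        have hfin : (⟨p / blk n, (Nat.div_lt_iff_lt_mul (blk_pos n)).2 h1⟩ : Fin (N n)) = v := Fin.ext hq
        rw [hfin, Function.update_self]
        simp only [List.length_take, length_ptBits, bits, List.getElem_ofFn, Nat.min_eq_left (show v.val * blk n ≤ ptLen n by omega)]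
        congr 1
        exact Fin.ext hr
      · push Not at hp2
        rw [List.getElem_append_right (by simp [length_bits]; omega)]
        simp only [List.length_append, List.length_take, length_ptBits, length_bits, List.getElem_drop]
        rw [getElem_ptBits]
        have hidx : (v.val + 1) * blk n + (p - (min (v.val * blk n) (ptLen n) + (Mof n + 1))) = p := by
          rw [Nat.min_eq_left (by omega), Nat.succ_mul]; omega
        have hne : (⟨p / blk n, (Nat.div_lt_iff_lt_mul (blk_pos n)).2 h1⟩ : Fin (N n)) ≠ v := by
          intro h
          have h' := congrArg Fin.val h
          simp only at h'
          have h3 := Nat.lt_mul_div_succ p (blk_pos n)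
          rw [h', Nat.mul_comm, Nat.succ_mul] at h3
          omega
        simp only [hidx, Function.update_of_ne hne]

/-- Entries of `List.takeD`. [folklore] -/
theorem getD_takeD {α : Type*} (d : α) : ∀ (k : ℕ) (w : List α) (p : ℕ),
    (List.takeD k w d).getD p d = if p < k then w.getD p d else d
  | 0, w, p => by simp
  | k + 1, w, 0 => by cases w <;> simp
  | k + 1, w, p + 1 => by
    rw [List.takeD_succ, List.getD_cons_succ, getD_takeD d k w.tail p]
    cases w <;> simp

/-- **The point read off a word, as a string**: the first `ptLen n` symbols of `w`, padded with `0`s,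
are the point bits of `xOf n w`. [cite: TrevisanVadhan2007, Thm. 4.3 (proof)] -/
theorem takeD_eq_ptBits_xOf (n : ℕ) (w : List Bool) : List.takeD (ptLen n) w false = ptBits n (xOf n w) := by
  apply List.ext_getElem
  · simp [List.takeD_length]
  · intro p h1 h2
    have hp : p < ptLen n := by simpa [List.takeD_length] using h1
    rw [getElem_ptBits, ← List.getD_eq_getElem _ false h1, getD_takeD, if_pos hp]
    simp only [xOf, encF_decF, Nat.div_add_mod']

/-! ### Writing a block; the challenges; the point of a stage -/

/-- **The block-write operation** on `⟨P, ⟨⟨1ᵛ, f⟩, ρ⟩⟩`: `P` with block `v` replaced by `ρ` (block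
length read off `f`), clipped to additive growth. [folklore] -/
def writeOpF : List Bool → List Bool :=
  clipOp (appF ∘ fanoutFn (appF ∘ fanoutFn
      (takeFn ∘ fanoutFn (HashBricks.umulFn ∘ fanoutFn (fstF ∘ fstF ∘ sndF) (blkLen1 ∘ (sndF ∘ fstF ∘ sndF))) fstF)
      (sndF ∘ sndF))
    (dropFn ∘ fanoutFn (HashBricks.umulFn ∘ fanoutFn (List.cons true ∘ fstF ∘ fstF ∘ sndF) (blkLen1 ∘ (sndF ∘ fstF ∘ sndF))) fstF))
where
  /-- `1^{M+1}`-length string from a modulus accessor -/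
  blkLen1 : List Bool → List Bool := dropFn ∘ fanoutFn (fun _ => [true]) (fun w => w)

/-- `writeOpF ∈ FP`. [folklore] -/
theorem writeOpF_mem_FP : writeOpF ∈ FP := by
  have hbl : writeOpF.blkLen1 ∈ FP := comp_mem_FP dropFn_mem_FP (fanoutFn_mem_FP (const_mem_FP _) (PolyTimeComputable.id _))
  have hv : (fstF ∘ fstF ∘ sndF : List Bool → List Bool) ∈ FP := comp_mem_FP fstF_mem_FP (comp_mem_FP fstF_mem_FP sndF_mem_FP)
  have hf : (sndF ∘ fstF ∘ sndF : List Bool → List Bool) ∈ FP := comp_mem_FP sndF_mem_FP (comp_mem_FP fstF_mem_FP sndF_mem_FP)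
  refine clipOp_mem_FP (comp_mem_FP appF_mem_FP (fanoutFn_mem_FP (comp_mem_FP appF_mem_FP (fanoutFn_mem_FP
    (comp_mem_FP takeFn_mem_FP (fanoutFn_mem_FP (comp_mem_FP HashBricks.umulFn_mem_FP (fanoutFn_mem_FP hv (comp_mem_FP hbl hf)))
      fstF_mem_FP)) (comp_mem_FP sndF_mem_FP sndF_mem_FP)))
    (comp_mem_FP dropFn_mem_FP (fanoutFn_mem_FP (comp_mem_FP HashBricks.umulFn_mem_FP (fanoutFn_mem_FP
      (comp_mem_FP (cons_mem_FP true) hv) (comp_mem_FP hbl hf))) fstF_mem_FP))))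

/-- **Value of the block write** on a point string (`v < N n`, `ρ` of `blk n` bits). [folklore] -/
theorem writeOpF_apply (n : ℕ) (x : Fin (N n) → K n) (v : Fin (N n)) (ρ : K n) :
    writeOpF (boolPair (ptBits n x) (boolPair (boolPair (ones v.val) (modStr (Mof n))) (bits (Mof n) ρ))) =
      ptBits n (Function.update x v ρ) := by
  have hbl : writeOpF.blkLen1 (modStr (Mof n)) = (modStr (Mof n)).drop 1 := by
    simp [writeOpF.blkLen1]
  have hraw : (appF ∘ fanoutFn (appF ∘ fanoutFn
      (takeFn ∘ fanoutFn (HashBricks.umulFn ∘ fanoutFn (fstF ∘ fstF ∘ sndF) (writeOpF.blkLen1 ∘ (sndF ∘ fstF ∘ sndF))) fstF)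
      (sndF ∘ sndF))
      (dropFn ∘ fanoutFn (HashBricks.umulFn ∘ fanoutFn (List.cons true ∘ fstF ∘ fstF ∘ sndF)
        (writeOpF.blkLen1 ∘ (sndF ∘ fstF ∘ sndF))) fstF))
      (boolPair (ptBits n x) (boolPair (boolPair (ones v.val) (modStr (Mof n))) (bits (Mof n) ρ))) =
      ptBits n (Function.update x v ρ) := by
    simp only [Function.comp_apply, fanoutFn_apply, fstF_boolPair, sndF_boolPair, hbl, HashBricks.umulFn_apply, ones,
      List.length_replicate, List.length_cons, List.length_drop, (modStr_top _).1, takeFn_boolPair, dropFn_boolPair,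
      appF_boolPair, ptBits_update, List.append_assoc]
    rw [show Mof n + 1 + 1 - 1 = blk n from rfl]
  rw [writeOpF, clipOp_eq, hraw]
  rw [hraw, fstF_boolPair, sndF_boolPair, length_ptBits, length_ptBits]
  simp

/-- **The point string is preserved in length by a write.** [folklore] -/
theorem length_writeOpF_pt (n : ℕ) (x : Fin (N n) → K n) (v : Fin (N n)) (ρ : K n) :
    (writeOpF (boolPair (ptBits n x) (boolPair (boolPair (ones v.val) (modStr (Mof n))) (bits (Mof n) ρ)))).length = ptLen n := by
  rw [writeOpF_apply, length_ptBits]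

/-! ### Concatenation folds: blocks and singletons -/

/-- Length of a concatenation of equal blocks. [folklore] -/
theorem length_ccat_of_eq {g : ℕ → List Bool} {T : ℕ} : ∀ {k : ℕ}, (∀ u < k, (g u).length = T) → (ccat g k).length = k * T
  | 0, _ => by simp
  | k + 1, h => by
    rw [ccat_succ, List.length_append, length_ccat_of_eq (fun u hu => h u (Nat.lt_succ_of_lt hu)), h k (Nat.lt_succ_self k),
      Nat.succ_mul]

/-- **Block `u` of a concatenation of equal blocks is piece `u`.** [folklore] -/
theorem blk_ccat {g : ℕ → List Bool} {T : ℕ} : ∀ {k : ℕ}, (∀ u < k, (g u).length = T) → ∀ {u : ℕ}, u < k →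
    HashBricks.blk (ccat g k) T u = g u
  | 0, _, u, hu => absurd hu (Nat.not_lt_zero _)
  | k + 1, h, u, hu => by
    have hk : (ccat g k).length = k * T := length_ccat_of_eq fun u hu => h u (Nat.lt_succ_of_lt hu)
    rw [HashBricks.blk, ccat_succ]
    rcases Nat.lt_succ_iff_lt_or_eq.1 hu with hu' | rfl
    · have h1 : u * T + T ≤ k * T := by rw [← Nat.succ_mul]; exact Nat.mul_le_mul_right _ hu'
      rw [List.drop_append_of_le_length (by rw [hk]; omega), List.take_append_of_le_length (by rw [List.length_drop, hk]; omega)]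
      exact blk_ccat (fun u hu => h u (Nat.lt_succ_of_lt hu)) hu'
    · rw [List.drop_append_of_le_length (by rw [hk]) , List.drop_eq_nil_of_le (by rw [hk]), List.nil_append,
        List.take_of_length_le (by rw [h u (Nat.lt_succ_self u)])]

/-! ### The challenges read off the coins -/

/-- **Challenge `j`** of the coin string `r`: the field element whose bits are block `j` of `r`. [folklore] -/
def coinVal (n : ℕ) (r : List Bool) (j : ℕ) : K n := decF (Mof n) fun l => r.getD (j * blk n + l.val) false

/-- Block `j` of the coins spells challenge `j` (`r` long enough). [folklore] -/
theorem blk_coins (n : ℕ) (r : List Bool) {j : ℕ} (hj : (j + 1) * blk n ≤ r.length) :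
    HashBricks.blk r (blk n) j = bits (Mof n) (coinVal n r j) := by
  rw [coinVal, bits_decF, HashBricks.blk]
  have hge : blk n ≤ r.length - j * blk n := by rw [Nat.succ_mul] at hj; omega
  apply List.ext_getElem
  · simp only [List.length_take, List.length_drop, List.length_ofFn, Nat.min_eq_left hge]
  · intro l h1 h2
    rw [List.getElem_ofFn, List.getElem_take, List.getElem_drop, List.getD_eq_getElem]

/-! ### The point of a stage of a run -/

/-- **The core record** of the checker: `⟨⟨w, r⟩, ⟨e, ⟨1ⁿ, ⟨1ⁱ, ⟨1^{m'}, ⟨1ᶻ, f⟩⟩⟩⟩⟩⟩` — input word, coins,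
oracle carrier, and the parsed parameters: size `n`, start stage `i`, number of stages `m' = mlen n - i`,
the padding budget `Z = pre n + mlen n - i` (the query words of stage `s` carry `Z - s - 1` zeros), the
modulus `f = modStr (Mof n)`. [folklore] -/
def coreRec (w r e : List Bool) (n i m' Z : ℕ) (f : List Bool) : List Bool :=
  boolPair (boolPair w r) (boolPair e (boolPair (ones n) (boolPair (ones i) (boolPair (ones m') (boolPair (ones Z) f)))))

/-- **The stage record** `⟨core, ⟨1ᵗ, 1ˢ⟩⟩` (run `t`, stage `s`). [folklore] -/
def stRec (core : List Bool) (t s : ℕ) : List Bool := boolPair core (boolPair (ones t) (ones s))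

section Accessors

/-- `w` of a stage record. [folklore] -/
def qW : List Bool → List Bool := fstF ∘ fstF ∘ fstF
/-- `r` of a stage record. [folklore] -/
def qR : List Bool → List Bool := sndF ∘ fstF ∘ fstF
/-- `e` of a stage record. [folklore] -/
def qE : List Bool → List Bool := fstF ∘ sndF ∘ fstF
/-- `1ⁿ` of a stage record. [folklore] -/
def qN : List Bool → List Bool := nthF 1 ∘ sndF ∘ fstF
/-- `1ⁱ` of a stage record. [folklore] -/
def qI : List Bool → List Bool := nthF 2 ∘ sndF ∘ fstF
/-- `1^{m'}` of a stage record. [folklore] -/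
def qM : List Bool → List Bool := nthF 3 ∘ sndF ∘ fstF
/-- `1ᶻ` of a stage record. [folklore] -/
def qZ : List Bool → List Bool := nthF 4 ∘ sndF ∘ fstF
/-- `f` of a stage record. [folklore] -/
def qF : List Bool → List Bool := sndPow 4 ∘ sndF ∘ fstF
/-- `1ᵗ` of a stage record. [folklore] -/
def qT : List Bool → List Bool := fstF ∘ sndF
/-- `1ˢ` of a stage record. [folklore] -/
def qS : List Bool → List Bool := sndF ∘ sndF

/-- The accessors are in `FP`. [folklore] -/
theorem q_mem_FP : qW ∈ FP ∧ qR ∈ FP ∧ qE ∈ FP ∧ qN ∈ FP ∧ qI ∈ FP ∧ qM ∈ FP ∧ qZ ∈ FP ∧ qF ∈ FP ∧ qT ∈ FP ∧ qS ∈ FP := by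
  have hsf : (sndF ∘ fstF : List Bool → List Bool) ∈ FP := comp_mem_FP sndF_mem_FP fstF_mem_FP
  exact ⟨comp_mem_FP fstF_mem_FP (comp_mem_FP fstF_mem_FP fstF_mem_FP), comp_mem_FP sndF_mem_FP (comp_mem_FP fstF_mem_FP fstF_mem_FP),
    comp_mem_FP fstF_mem_FP hsf, comp_mem_FP (nthF_mem_FP 1) hsf, comp_mem_FP (nthF_mem_FP 2) hsf, comp_mem_FP (nthF_mem_FP 3) hsf,
    comp_mem_FP (nthF_mem_FP 4) hsf, comp_mem_FP (sndPow_mem_FP 4) hsf, comp_mem_FP fstF_mem_FP sndF_mem_FP,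
    comp_mem_FP sndF_mem_FP sndF_mem_FP⟩

/-- Values of the accessors. [folklore] -/
theorem q_apply (w r e : List Bool) (n i m' Z : ℕ) (f : List Bool) (t s : ℕ) :
    qW (stRec (coreRec w r e n i m' Z f) t s) = w ∧ qR (stRec (coreRec w r e n i m' Z f) t s) = r ∧
    qE (stRec (coreRec w r e n i m' Z f) t s) = e ∧ qN (stRec (coreRec w r e n i m' Z f) t s) = ones n ∧
    qI (stRec (coreRec w r e n i m' Z f) t s) = ones i ∧ qM (stRec (coreRec w r e n i m' Z f) t s) = ones m' ∧
    qZ (stRec (coreRec w r e n i m' Z f) t s) = ones Z ∧ qF (stRec (coreRec w r e n i m' Z f) t s) = f ∧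
    qT (stRec (coreRec w r e n i m' Z f) t s) = ones t ∧ qS (stRec (coreRec w r e n i m' Z f) t s) = ones s := by
  simp [qW, qR, qE, qN, qI, qM, qZ, qF, qT, qS, stRec, coreRec, nthF, sndPow]

end Accessors

/-- `1^{ptLen n}` from a stage record: `N n · blk n` (`N n + 1` from `nSuccOf`, `blk n` from `|f| - 1`). [folklore] -/
def ptLenOf : List Bool → List Bool :=
  HashBricks.umulFn ∘ fanoutFn (dropFn ∘ fanoutFn (fun _ => [true]) (nSuccOf ∘ qN)) (dropFn ∘ fanoutFn (fun _ => [true]) qF)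

/-- `ptLenOf ∈ FP`. [folklore] -/
theorem ptLenOf_mem_FP : ptLenOf ∈ FP :=
  comp_mem_FP HashBricks.umulFn_mem_FP (fanoutFn_mem_FP
    (comp_mem_FP dropFn_mem_FP (fanoutFn_mem_FP (const_mem_FP _) (comp_mem_FP nSuccOf_mem_FP q_mem_FP.2.2.2.1)))
    (comp_mem_FP dropFn_mem_FP (fanoutFn_mem_FP (const_mem_FP _) q_mem_FP.2.2.2.2.2.2.2.1)))

/-- Value of `ptLenOf` (as a length). [folklore] -/
theorem length_ptLenOf (w r e : List Bool) (n i m' Z t s : ℕ) :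
    (ptLenOf (stRec (coreRec w r e n i m' Z (modStr (Mof n))) t s)).length = ptLen n := by
  obtain ⟨-, -, -, hN, -, -, -, hF, -, -⟩ := q_apply w r e n i m' Z (modStr (Mof n)) t s
  simp only [ptLenOf, Function.comp_apply, fanoutFn_apply, hN, hF, nSuccOf_apply, dropFn_boolPair, List.length_singleton,
    HashBricks.umulFn_apply, fstF_boolPair, sndF_boolPair, ones, List.length_replicate, List.length_drop, (modStr_top _).1]
  rw [ptLen, show Mof n + 1 + 1 - 1 = blk n from rfl, Nat.add_sub_cancel]

/-- **The start point string** `P₀ = takeD (ptLen n) w 0 = ptBits n (xOf n w)` of a stage record. [cite: TrevisanVadhan2007, Thm. 4.3 (proof)] -/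
def pt0Of : List Bool → List Bool := fstF ∘ padTakeFn ∘ fanoutFn ptLenOf qW

/-- `pt0Of ∈ FP`. [folklore] -/
theorem pt0Of_mem_FP : pt0Of ∈ FP :=
  comp_mem_FP fstF_mem_FP (comp_mem_FP padTakeFn_mem_FP (fanoutFn_mem_FP ptLenOf_mem_FP q_mem_FP.1))

/-- Value of `pt0Of`. [cite: TrevisanVadhan2007, Thm. 4.3 (proof)] -/
theorem pt0Of_apply (w r e : List Bool) (n i m' Z t s : ℕ) :
    pt0Of (stRec (coreRec w r e n i m' Z (modStr (Mof n))) t s) = ptBits n (xOf n w) := by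
  have hl := length_ptLenOf w r e n i m' Z t s
  obtain ⟨hW, -⟩ := q_apply w r e n i m' Z (modStr (Mof n)) t s
  rw [pt0Of, Function.comp_apply, Function.comp_apply, fanoutFn_apply, hW, padTakeFn_boolPair, fstF_boolPair, hl,
    takeD_eq_ptBits_xOf]

/-- **The write piece of stage `s'`** on `⟨stRec, 1^{s'}⟩`: `⟨⟨1^{v_{s'}}, f⟩, ρ_{t, s'}⟩` — the axis of the
absolute stage `i + s'` (`axisOf`) and block `t · m' + s'` of the coins (`blockAt`). [cite: LundEtAl1992, §3] -/
def writePieceF : List Bool → List Bool :=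
  fanoutFn (fanoutFn (axisOf ∘ fanoutFn (qN ∘ fstF) (appF ∘ fanoutFn (qI ∘ fstF) sndF)) (qF ∘ fstF))
    (blockAt ∘ fanoutFn (qR ∘ fstF)
      (fanoutFn (appF ∘ fanoutFn (HashBricks.umulFn ∘ fanoutFn (qT ∘ fstF) (qM ∘ fstF)) sndF) (qF ∘ fstF)))

/-- `writePieceF ∈ FP`. [folklore] -/
theorem writePieceF_mem_FP : writePieceF ∈ FP := by
  obtain ⟨-, hR, -, hN, hI, hM, -, hF, hT, -⟩ := q_mem_FP
  exact fanoutFn_mem_FP (fanoutFn_mem_FP (comp_mem_FP axisSel_mem_FP.1 (fanoutFn_mem_FP (comp_mem_FP hN fstF_mem_FP)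
      (comp_mem_FP appF_mem_FP (fanoutFn_mem_FP (comp_mem_FP hI fstF_mem_FP) sndF_mem_FP)))) (comp_mem_FP hF fstF_mem_FP))
    (comp_mem_FP blockAt_mem_FP (fanoutFn_mem_FP (comp_mem_FP hR fstF_mem_FP) (fanoutFn_mem_FP
      (comp_mem_FP appF_mem_FP (fanoutFn_mem_FP (comp_mem_FP HashBricks.umulFn_mem_FP (fanoutFn_mem_FP (comp_mem_FP hT fstF_mem_FP)
        (comp_mem_FP hM fstF_mem_FP))) sndF_mem_FP)) (comp_mem_FP hF fstF_mem_FP))))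

/-- **Value of the write piece** (`i + s' < mlen n`, coins long enough). [cite: LundEtAl1992, §3] -/
theorem writePieceF_apply {n : ℕ} (hn : 0 < n) (w r e : List Bool) {i m' Z t s s' : ℕ} (hs' : i + s' < mlen n)
    (hr : (t * m' + s' + 1) * blk n ≤ r.length) :
    writePieceF (boolPair (stRec (coreRec w r e n i m' Z (modStr (Mof n))) t s) (ones s')) =
      boolPair (boolPair (ones (opVar (opAt n hn (i + s'))).val) (modStr (Mof n))) (bits (Mof n) (coinVal n r (t * m' + s'))) := by
  set S := stRec (coreRec w r e n i m' Z (modStr (Mof n))) t s with hSdef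
  obtain ⟨-, hR, -, hN, hI, hM, -, hF, hT, -⟩ := q_apply w r e n i m' Z (modStr (Mof n)) t s
  have h1 : (axisOf ∘ fanoutFn (qN ∘ fstF) (appF ∘ fanoutFn (qI ∘ fstF) sndF)) (boolPair S (ones s')) =
      ones (opVar (opAt n hn (i + s'))).val := by
    rw [Function.comp_apply, fanoutFn_apply, Function.comp_apply, fstF_boolPair, hN, Function.comp_apply, fanoutFn_apply,
      Function.comp_apply, fstF_boolPair, hI, sndF_boolPair, appF_boolPair, ones, ones, List.replicate_append_replicate, ← ones,
      ← ones, ← sCtx, axisOf_apply hs', opAt_eq hn hs']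
  have h2 : (blockAt ∘ fanoutFn (qR ∘ fstF)
      (fanoutFn (appF ∘ fanoutFn (HashBricks.umulFn ∘ fanoutFn (qT ∘ fstF) (qM ∘ fstF)) sndF) (qF ∘ fstF))) (boolPair S (ones s')) =
      bits (Mof n) (coinVal n r (t * m' + s')) := by
    rw [Function.comp_apply, fanoutFn_apply, Function.comp_apply, fstF_boolPair, hR, fanoutFn_apply, Function.comp_apply,
      fanoutFn_apply, Function.comp_apply, fanoutFn_apply, Function.comp_apply, fstF_boolPair, hT, Function.comp_apply,
      fstF_boolPair, hM, HashBricks.umulFn_apply, fstF_boolPair, sndF_boolPair, sndF_boolPair, appF_boolPair,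
      Function.comp_apply, fstF_boolPair, hF]
    simp only [ones, List.length_replicate, List.replicate_append_replicate]
    rw [← ones, blockAt_apply, blk_coins n r hr]
  rw [writePieceF, fanoutFn_apply, fanoutFn_apply, h1, h2, Function.comp_apply, fstF_boolPair, hF]

/-- Initialisation of the point fold: `⟨stRec, ⟨encodeNat s, ⟨1⁰, P₀⟩⟩⟩`. [folklore] -/
def initPt : List Bool → List Bool :=
  fanoutFn (fun z => z) (fanoutFn (lenBinF ∘ qS) (fanoutFn (fun _ => []) pt0Of))

/-- `initPt ∈ FP`. [folklore] -/
theorem initPt_mem_FP : initPt ∈ FP :=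
  fanoutFn_mem_FP (PolyTimeComputable.id _) (fanoutFn_mem_FP (comp_mem_FP lenBinF_mem_FP q_mem_FP.2.2.2.2.2.2.2.2.2)
    (fanoutFn_mem_FP (const_mem_FP _) pt0Of_mem_FP))

/-- **The point brick**: the point string of stage `s` of run `t` — `s` block writes folded over the start
point. [cite: LundEtAl1992, §3] -/
def pointF : List Bool → List Bool := sndPow 2 ∘ foldLoop writeOpF (clipF 8 writePieceF) X ∘ initPt

/-- **`pointF ∈ FP`.** [folklore] -/
theorem pointF_mem_FP : pointF ∈ FP :=
  comp_mem_FP (sndPow_mem_FP 2) (comp_mem_FP (foldLoop_clipF_mem_FP 8 writeOpF_mem_FP (length_clipOp_le _) writePieceF_mem_FP _)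
    initPt_mem_FP)

/-- The challenge sequence of run `t` read off the coins: `ρ s' = coinVal n r (t m' + s')`. [folklore] -/
def runCoins (n : ℕ) (r : List Bool) (t m' : ℕ) (s' : ℕ) : K n := coinVal n r (t * m' + s')

/-- **Value of the point brick**: the point string of `pointSeq` of the chain `tvChain n hn` from
`xOf n w` along the challenges of run `t` (`s ≤ m'`, `i + m' ≤ mlen n`, `|w| ≥ ptLen n` irrelevant, coins
of length `≥ (t m' + m') · blk n`). [cite: LundEtAl1992, §3] -/
theorem pointF_apply {n : ℕ} (hn : 0 < n) {w : List Bool} (hw : ptLen n ≤ w.length) (r e : List Bool) {i m' Z t s : ℕ}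
    (hs : s ≤ m') (him : i + m' ≤ mlen n) (hr : (t * m' + m') * blk n ≤ r.length) :
    pointF (stRec (coreRec w r e n i m' Z (modStr (Mof n))) t s) =
      ptBits n ((tvChain n hn).pointSeq i (xOf n w) (runCoins n r t m') s) := by
  set S := stRec (coreRec w r e n i m' Z (modStr (Mof n))) t s with hSdef
  obtain ⟨-, -, -, -, -, -, -, -, -, hS⟩ := q_apply w r e n i m' Z (modStr (Mof n)) t s
  have hk : s ≤ (X : Polynomial ℕ).eval S.length := by
    simp only [eval_X, hSdef, stRec, length_boolPair, ones, List.length_replicate]; omega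
  have hinit : initPt S = boolPair S (boolPair (encodeNat s) (boolPair (ones 0) (ptBits n (xOf n w)))) := by
    simp only [initPt, fanoutFn_apply, Function.comp_apply, hS, lenBinF_apply, ones, List.length_replicate, hSdef, pt0Of_apply]
    rfl
  -- the pieces actually folded, and their values
  have hpiece : ∀ s' < s, writePieceF (boolPair S (ones s')) =
      boolPair (boolPair (ones (opVar (opAt n hn (i + s'))).val) (modStr (Mof n))) (bits (Mof n) (runCoins n r t m' s')) :=
    fun s' hs' => writePieceF_apply hn w r e (by omega) (le_trans (Nat.mul_le_mul_right _ (by omega)) hr)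
  rw [pointF, Function.comp_apply, Function.comp_apply, hinit, foldLoop_apply _ _ hk, sndPow_succ_boolPair, sndPow_succ_boolPair,
    sndPow_zero_boolPair, foldAcc_clipF (fun s' _ hs' => ?_)]
  · -- the fold of writes is the point sequence
    suffices H : ∀ s'' ≤ s, foldAcc writeOpF writePieceF S 0 s'' (ptBits n (xOf n w)) =
        ptBits n ((tvChain n hn).pointSeq i (xOf n w) (runCoins n r t m') s'') from H s le_rfl
    intro s'' hs''
    induction s'' with
    | zero => simp
    | succ s'' ih =>
      rw [foldAcc_succ', ih (Nat.le_of_succ_le hs''), Nat.zero_add, hpiece s'' (by omega), ChainCheck.Chain.pointSeq_succ]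
      exact writeOpF_apply n _ (opVar (opAt n hn (i + s''))) (runCoins n r t m' s'')
  · rw [hpiece s' (by omega), length_boolPair, length_boolPair, length_bits, (modStr_top _).1]
    have hv := (opVar (opAt n hn (i + s'))).isLt
    have hNw : N n ≤ w.length := (N_le_ptLen n).trans hw
    have hS : 2 * w.length + (Mof n + 2) ≤ S.length := by
      simp only [hSdef, stRec, coreRec, length_boolPair, (modStr_top _).1]; omega
    simp only [ones, List.length_replicate]
    omega

/-! ### Query words and the oracle's answers -/

/-- **The answer-block context** `⟨P', ⟨⟨1^{zc}, f⟩, e⟩⟩`: a point string, the zero-padding count of the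
query words, the modulus, the oracle carrier. [folklore] -/
def abCtx (P : List Bool) (zc : ℕ) (f e : List Bool) : List Bool := boolPair P (boolPair (boolPair (ones zc) f) e)

/-- `P'` of the piece argument `⟨abCtx, 1ˡ⟩`. [folklore] -/
def aP : List Bool → List Bool := fstF ∘ fstF
/-- `1^{zc}` of `⟨abCtx, 1ˡ⟩`. [folklore] -/
def aZ : List Bool → List Bool := fstF ∘ fstF ∘ sndF ∘ fstF
/-- `f` of `⟨abCtx, 1ˡ⟩`. [folklore] -/
def aF : List Bool → List Bool := sndF ∘ fstF ∘ sndF ∘ fstF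
/-- `e` of `⟨abCtx, 1ˡ⟩`. [folklore] -/
def aE : List Bool → List Bool := sndF ∘ sndF ∘ fstF
/-- `1ˡ` of `⟨abCtx, 1ˡ⟩`. [folklore] -/
def aL : List Bool → List Bool := sndF

/-- The accessors are in `FP`. [folklore] -/
theorem a_mem_FP : aP ∈ FP ∧ aZ ∈ FP ∧ aF ∈ FP ∧ aE ∈ FP ∧ aL ∈ FP :=
  ⟨comp_mem_FP fstF_mem_FP fstF_mem_FP,
   comp_mem_FP fstF_mem_FP (comp_mem_FP fstF_mem_FP (comp_mem_FP sndF_mem_FP fstF_mem_FP)),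
   comp_mem_FP sndF_mem_FP (comp_mem_FP fstF_mem_FP (comp_mem_FP sndF_mem_FP fstF_mem_FP)),
   comp_mem_FP sndF_mem_FP (comp_mem_FP sndF_mem_FP fstF_mem_FP), sndF_mem_FP⟩

/-- Values of the accessors. [folklore] -/
theorem a_apply (P : List Bool) (zc : ℕ) (f e : List Bool) (l : ℕ) :
    aP (boolPair (abCtx P zc f e) (ones l)) = P ∧ aZ (boolPair (abCtx P zc f e) (ones l)) = ones zc ∧
    aF (boolPair (abCtx P zc f e) (ones l)) = f ∧ aE (boolPair (abCtx P zc f e) (ones l)) = e ∧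
    aL (boolPair (abCtx P zc f e) (ones l)) = ones l := by
  simp [aP, aZ, aF, aE, aL, abCtx]

/-- **The query word** on `⟨abCtx, 1ˡ⟩`: `P' ++ natBits (M+1) l ++ 0^{zc}` (`wordOf`). [cite: TrevisanVadhan2007, Thm. 4.3 (proof)] -/
def qwordF : List Bool → List Bool := appF ∘ fanoutFn (appF ∘ fanoutFn aP (nodeOf aL aF)) (Kannan.zerosFn ∘ aZ)

/-- `qwordF ∈ FP`. [folklore] -/
theorem qwordF_mem_FP : qwordF ∈ FP := by
  obtain ⟨hP, hZ, hF, -, hL⟩ := a_mem_FP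
  exact comp_mem_FP appF_mem_FP (fanoutFn_mem_FP (comp_mem_FP appF_mem_FP (fanoutFn_mem_FP hP (nodeOf_mem_FP hL hF)))
    (comp_mem_FP Kannan.zerosFn_mem_FP hZ))

/-- **Value of the query word**: `wordOf n y l (ptLen n + blk n + zc)`. [cite: TrevisanVadhan2007, Thm. 4.3 (proof)] -/
theorem qwordF_apply (n : ℕ) (y : Fin (N n) → K n) (zc : ℕ) (e : List Bool) (l : Fin (blk n)) :
    qwordF (boolPair (abCtx (ptBits n y) zc (modStr (Mof n)) e) (ones l.val)) = wordOf n y l (ptLen n + blk n + zc) := by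
  obtain ⟨hP, hZ, hF, -, hL⟩ := a_apply (ptBits n y) zc (modStr (Mof n)) e l.val
  have hl2 : l.val < 2 ^ (Mof n + 1) := lt_trans l.isLt (Nat.lt_two_pow_self (n := Mof n + 1))
  have hnode := nodeOf_apply (Mof n) (G := aL) (F := aF) hF (by rw [hL, ones, List.length_replicate]) hl2
  rw [qwordF, Function.comp_apply, fanoutFn_apply, Function.comp_apply, fanoutFn_apply, hP, hnode, Function.comp_apply, hZ,
    Kannan.zerosFn_apply, appF_boolPair, appF_boolPair, wordOf, ← natBits_eq_bits_nodeVal]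
  have hzc : (ones zc).length = ptLen n + blk n + zc - ptLen n - blk n := by rw [ones, List.length_replicate]; omega
  rw [hzc]

/-- **One oracle answer** on `⟨abCtx, 1ˡ⟩`, the oracle presented by the access brick `acc` on
`⟨query, e⟩`: the bit `[acc ⟨query, e⟩ = 1]`. [cite: Santhanam2009, Lemma 12] -/
def bitPieceF (acc : List Bool → List Bool) : List Bool → List Bool :=
  eqPairFn ∘ fanoutFn (acc ∘ fanoutFn qwordF aE) (fun _ => [true])

/-- `bitPieceF acc ∈ FP` for `acc ∈ FP`. [folklore] -/
theorem bitPieceF_mem_FP {acc : List Bool → List Bool} (hacc : acc ∈ FP) : bitPieceF acc ∈ FP :=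
  comp_mem_FP eqPairFn_mem_FP (fanoutFn_mem_FP (comp_mem_FP hacc (fanoutFn_mem_FP qwordF_mem_FP a_mem_FP.2.2.2.1)) (const_mem_FP _))

/-- The Boolean oracle presented by `acc` on the carrier `e`. [folklore] -/
def accOracle (acc : List Bool → List Bool) (e : List Bool) (q : List Bool) : Bool := decide (acc (boolPair q e) = [true])

/-- **Value of one answer.** [folklore] -/
theorem bitPieceF_apply (acc : List Bool → List Bool) (n : ℕ) (y : Fin (N n) → K n) (zc : ℕ) (e : List Bool) (l : Fin (blk n)) :
    bitPieceF acc (boolPair (abCtx (ptBits n y) zc (modStr (Mof n)) e) (ones l.val)) =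
      [accOracle acc e (wordOf n y l (ptLen n + blk n + zc))] := by
  obtain ⟨-, -, -, hE, -⟩ := a_apply (ptBits n y) zc (modStr (Mof n)) e l.val
  simp only [bitPieceF, Function.comp_apply, fanoutFn_apply, qwordF_apply, hE, eqPairFn_boolPair, accOracle]

/-- Initialisation of the answer fold: `⟨abCtx, ⟨encodeNat (blk n), ⟨1⁰, ε⟩⟩⟩`. [folklore] -/
def initAB : List Bool → List Bool :=
  fanoutFn (fun z => z) (fanoutFn (lenBinF ∘ dropFn ∘ fanoutFn (fun _ => [true]) (sndF ∘ fstF ∘ sndF)) (fun _ => boolPair [] []))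

/-- `initAB ∈ FP`. [folklore] -/
theorem initAB_mem_FP : initAB ∈ FP :=
  fanoutFn_mem_FP (PolyTimeComputable.id _) (fanoutFn_mem_FP (comp_mem_FP lenBinF_mem_FP (comp_mem_FP dropFn_mem_FP
    (fanoutFn_mem_FP (const_mem_FP _) (comp_mem_FP sndF_mem_FP (comp_mem_FP fstF_mem_FP sndF_mem_FP))))) (const_mem_FP _))

/-- Value of `initAB`. [folklore] -/
theorem initAB_apply (P : List Bool) (zc n : ℕ) (e : List Bool) :
    initAB (abCtx P zc (modStr (Mof n)) e) = boolPair (abCtx P zc (modStr (Mof n)) e) (boolPair (encodeNat (blk n)) (boolPair (ones 0) [])) := by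
  simp only [initAB, fanoutFn_apply, Function.comp_apply, abCtx, sndF_boolPair, fstF_boolPair, dropFn_boolPair, List.length_singleton,
    lenBinF_apply, List.length_drop, (modStr_top _).1]
  rw [show Mof n + 1 + 1 - 1 = blk n from rfl]; rfl

/-- **The answer block** at one point: the `blk n` answers, concatenated. [cite: TrevisanVadhan2007, Thm. 4.3 (proof)] -/
def ansBlkF (acc : List Bool → List Bool) : List Bool → List Bool := sndPow 2 ∘ foldLoop appF (clipF 1 (bitPieceF acc)) X ∘ initAB

/-- `ansBlkF acc ∈ FP` for `acc ∈ FP`. [folklore] -/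
theorem ansBlkF_mem_FP {acc : List Bool → List Bool} (hacc : acc ∈ FP) : ansBlkF acc ∈ FP :=
  comp_mem_FP (sndPow_mem_FP 2) (comp_mem_FP (foldLoop_clipF_mem_FP 1 appF_mem_FP length_appF_le (bitPieceF_mem_FP hacc) _)
    initAB_mem_FP)

/-- The level oracle presented by `acc` at the query length `len`. [folklore] -/
def lvlOracle (acc : List Bool → List Bool) (e : List Bool) (n len : ℕ) (y : Fin (N n) → K n) : K n :=
  decF (Mof n) fun l => accOracle acc e (wordOf n y l len)

/-- At a canonical length this is `pointOracle`. [folklore] -/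
theorem lvlOracle_eq_pointOracle (acc : List Bool → List Bool) (e : List Bool) (n i' : ℕ) :
    lvlOracle acc e n (h n i') = pointOracle (accOracle acc e) n i' := rfl

/-- **Value of the answer block**: the bits of the level oracle's value at the point. [cite: TrevisanVadhan2007, Thm. 4.3 (proof)] -/
theorem ansBlkF_apply (acc : List Bool → List Bool) (n : ℕ) (y : Fin (N n) → K n) (zc : ℕ) (e : List Bool) :
    ansBlkF acc (abCtx (ptBits n y) zc (modStr (Mof n)) e) = bits (Mof n) (lvlOracle acc e n (ptLen n + blk n + zc) y) := by
  set A := abCtx (ptBits n y) zc (modStr (Mof n)) e with hAdef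
  have hk : blk n ≤ (X : Polynomial ℕ).eval A.length := by
    simp only [eval_X, hAdef, abCtx, length_boolPair, (modStr_top _).1]
    rw [show blk n = Mof n + 1 from rfl]; omega
  rw [ansBlkF, Function.comp_apply, Function.comp_apply, initAB_apply, foldLoop_apply _ _ hk, sndPow_succ_boolPair,
    sndPow_succ_boolPair, sndPow_zero_boolPair, foldAcc_clipF (fun l _ hl => ?_), foldAcc_appF, List.nil_append, lvlOracle, bits_decF]
  · refine NWMachine.ccat_eq_ofFn _ _ fun l => ?_
    rw [Nat.zero_add, hAdef]
    exact bitPieceF_apply acc n y zc e l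
  · have hl' : l < blk n := by omega
    rw [hAdef, bitPieceF_apply acc n y zc e ⟨l, hl'⟩]
    simp

/-! ### The answers at the nodes of the axis line -/

/-- **The node-answer context** `⟨⟨P', ⟨1ᵛ, 1ᴰ⟩⟩, ⟨⟨1^{zc}, f⟩, e⟩⟩`. [folklore] -/
def naCtx (P : List Bool) (v D zc : ℕ) (f e : List Bool) : List Bool :=
  boolPair (boolPair P (boolPair (ones v) (ones D))) (boolPair (boolPair (ones zc) f) e)

/-- `P'` of `⟨naCtx, 1ᵘ⟩`. [folklore] -/
def nP : List Bool → List Bool := fstF ∘ fstF ∘ fstF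
/-- `1ᵛ` of `⟨naCtx, 1ᵘ⟩`. [folklore] -/
def nV : List Bool → List Bool := fstF ∘ sndF ∘ fstF ∘ fstF
/-- `f` of `⟨naCtx, 1ᵘ⟩`. [folklore] -/
def nF : List Bool → List Bool := sndF ∘ fstF ∘ sndF ∘ fstF
/-- `⟨⟨1^{zc}, f⟩, e⟩` of `⟨naCtx, 1ᵘ⟩`. [folklore] -/
def nTail : List Bool → List Bool := sndF ∘ fstF
/-- `1ᵘ` of `⟨naCtx, 1ᵘ⟩`. [folklore] -/
def nU : List Bool → List Bool := sndF

/-- The accessors are in `FP`. [folklore] -/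
theorem n_mem_FP : nP ∈ FP ∧ nV ∈ FP ∧ nF ∈ FP ∧ nTail ∈ FP ∧ nU ∈ FP :=
  ⟨comp_mem_FP fstF_mem_FP (comp_mem_FP fstF_mem_FP fstF_mem_FP),
   comp_mem_FP fstF_mem_FP (comp_mem_FP sndF_mem_FP (comp_mem_FP fstF_mem_FP fstF_mem_FP)),
   comp_mem_FP sndF_mem_FP (comp_mem_FP fstF_mem_FP (comp_mem_FP sndF_mem_FP fstF_mem_FP)),
   comp_mem_FP sndF_mem_FP fstF_mem_FP, sndF_mem_FP⟩

/-- Values of the accessors. [folklore] -/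
theorem n_apply (P : List Bool) (v D zc : ℕ) (f e : List Bool) (u : ℕ) :
    nP (boolPair (naCtx P v D zc f e) (ones u)) = P ∧ nV (boolPair (naCtx P v D zc f e) (ones u)) = ones v ∧
    nF (boolPair (naCtx P v D zc f e) (ones u)) = f ∧
    nTail (boolPair (naCtx P v D zc f e) (ones u)) = boolPair (boolPair (ones zc) f) e ∧
    nU (boolPair (naCtx P v D zc f e) (ones u)) = ones u := by
  simp [nP, nV, nF, nTail, nU, naCtx]

/-- **The block piece**: the answer block at the point with the axis coordinate set to node `u`.
[cite: LundEtAl1992, §3] -/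
def blkPieceF (acc : List Bool → List Bool) : List Bool → List Bool :=
  ansBlkF acc ∘ fanoutFn (writeOpF ∘ fanoutFn nP (fanoutFn (fanoutFn nV nF) (nodeOf nU nF))) nTail

/-- `blkPieceF acc ∈ FP` for `acc ∈ FP`. [folklore] -/
theorem blkPieceF_mem_FP {acc : List Bool → List Bool} (hacc : acc ∈ FP) : blkPieceF acc ∈ FP := by
  obtain ⟨hP, hV, hF, hT, hU⟩ := n_mem_FP
  exact comp_mem_FP (ansBlkF_mem_FP hacc) (fanoutFn_mem_FP (comp_mem_FP writeOpF_mem_FP (fanoutFn_mem_FP hP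
    (fanoutFn_mem_FP (fanoutFn_mem_FP hV hF) (nodeOf_mem_FP hU hF)))) hT)

/-- **Value of the block piece** (`u < 2^{M+1}`). [cite: LundEtAl1992, §3] -/
theorem blkPieceF_apply (acc : List Bool → List Bool) (n : ℕ) (y : Fin (N n) → K n) (v : Fin (N n)) (D zc : ℕ) (e : List Bool)
    {u : ℕ} (hu : u < 2 ^ (Mof n + 1)) :
    blkPieceF acc (boolPair (naCtx (ptBits n y) v.val D zc (modStr (Mof n)) e) (ones u)) =
      bits (Mof n) (lvlOracle acc e n (ptLen n + blk n + zc) (Function.update y v (nodeVal (Mof n) u))) := by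
  obtain ⟨hP, hV, hF, hT, hU⟩ := n_apply (ptBits n y) v.val D zc (modStr (Mof n)) e u
  have hnode := nodeOf_apply (Mof n) (G := nU) (F := nF) hF (by rw [hU, ones, List.length_replicate]) hu
  rw [blkPieceF, Function.comp_apply, fanoutFn_apply, Function.comp_apply, fanoutFn_apply, fanoutFn_apply, fanoutFn_apply, hP, hV,
    hF, hnode, hT, writeOpF_apply, ← abCtx, ansBlkF_apply]

/-- Initialisation of the node fold: `⟨naCtx, ⟨encodeNat D, ⟨1⁰, ε⟩⟩⟩`. [folklore] -/
def initNA : List Bool → List Bool :=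
  fanoutFn (fun z => z) (fanoutFn (lenBinF ∘ sndF ∘ sndF ∘ fstF) (fun _ => boolPair [] []))

/-- `initNA ∈ FP`. [folklore] -/
theorem initNA_mem_FP : initNA ∈ FP :=
  fanoutFn_mem_FP (PolyTimeComputable.id _) (fanoutFn_mem_FP (comp_mem_FP lenBinF_mem_FP
    (comp_mem_FP sndF_mem_FP (comp_mem_FP sndF_mem_FP fstF_mem_FP))) (const_mem_FP _))

/-- Value of `initNA`. [folklore] -/
theorem initNA_apply (P : List Bool) (v D zc : ℕ) (f e : List Bool) :
    initNA (naCtx P v D zc f e) = boolPair (naCtx P v D zc f e) (boolPair (encodeNat D) (boolPair (ones 0) [])) := by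
  simp only [initNA, fanoutFn_apply, Function.comp_apply, naCtx, sndF_boolPair, fstF_boolPair, lenBinF_apply, ones, List.length_replicate]
  rfl

/-- **The node-answer brick**: the `D` answer blocks at the nodes of the axis line — the string `Y` the
Lagrange brick consumes. [cite: LundEtAl1992, §3] [cite: AroraBarakCC2009, §8.3.3] -/
def nodeAnsF (acc : List Bool → List Bool) : List Bool → List Bool := sndPow 2 ∘ foldLoop appF (clipF 1 (blkPieceF acc)) X ∘ initNA

/-- `nodeAnsF acc ∈ FP` for `acc ∈ FP`. [folklore] -/
theorem nodeAnsF_mem_FP {acc : List Bool → List Bool} (hacc : acc ∈ FP) : nodeAnsF acc ∈ FP :=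
  comp_mem_FP (sndPow_mem_FP 2) (comp_mem_FP (foldLoop_clipF_mem_FP 1 appF_mem_FP length_appF_le (blkPieceF_mem_FP hacc) _)
    initNA_mem_FP)

/-- **Value of the node-answer brick**: `D ≤ 2^{M+1}` blocks, block `u` the bits of the level oracle at
the point shifted to node `u`. [cite: LundEtAl1992, §3] [cite: AroraBarakCC2009, §8.3.3] -/
theorem nodeAnsF_apply (acc : List Bool → List Bool) (n : ℕ) (y : Fin (N n) → K n) (v : Fin (N n)) {D : ℕ} (hD : D ≤ 2 ^ (Mof n + 1))
    (zc : ℕ) (e : List Bool) :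
    ∀ u < D, HashBricks.blk (nodeAnsF acc (naCtx (ptBits n y) v.val D zc (modStr (Mof n)) e)) (Mof n + 1) u =
      bits (Mof n) (lvlOracle acc e n (ptLen n + blk n + zc) (Function.update y v (nodeVal (Mof n) u))) := by
  set Nc := naCtx (ptBits n y) v.val D zc (modStr (Mof n)) e with hNdef
  have hk : D ≤ (X : Polynomial ℕ).eval Nc.length := by
    simp only [eval_X, hNdef, naCtx, length_boolPair, ones, List.length_replicate]; omega
  have hval : nodeAnsF acc Nc = ccat (fun u => bits (Mof n) (lvlOracle acc e n (ptLen n + blk n + zc)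
      (Function.update y v (nodeVal (Mof n) u)))) D := by
    rw [nodeAnsF, Function.comp_apply, Function.comp_apply, initNA_apply, foldLoop_apply _ _ hk, sndPow_succ_boolPair,
      sndPow_succ_boolPair, sndPow_zero_boolPair, foldAcc_clipF (fun u _ hu => ?_), foldAcc_appF, List.nil_append]
    · refine ccat_congr fun u hu => ?_
      rw [Nat.zero_add, hNdef, blkPieceF_apply acc n y v D zc e (hu.trans_le hD)]
    · have hu' : u < D := by omega
      rw [hNdef, blkPieceF_apply acc n y v D zc e (hu'.trans_le hD), length_bits]
      simp only [naCtx, length_boolPair, (modStr_top _).1]; omega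
  intro u hu
  rw [hval, blk_ccat (fun u _ => length_bits _ _) hu]

end TVChk

end Literature.Computability.Complexity

end
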